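import Mathlib
import HarnessLib
import Summits.FinalStateConjecture.FinalStateConjecture.Theorems.ZeroEnergyKerrOrBombKerrModeStabilityGrowthAlgebra
import Summits.FinalStateConjecture.FinalStateConjecture.Theorems.ZeroEnergyKerrOrBombKerrModeStabilityGrowthCalculus
import Summits.FinalStateConjecture.FinalStateConjecture.Theorems.ZeroEnergyKerrOrBombKerrModeStabilityLocalUniqueness

/-!
# Route ZeroEnergyKerrOrBomb · item `KerrModeStability` — the slice Lagrangian identity

Helper file for item stmt-FinalStateConjecture-10024 (`KerrModeStability`). For a bounded
Killing-mode pair `(ψ, χ)` on a horizon-penetrating Kerr–Schild chart and the annular cut-off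
`ζ = u_{R_far+1,1}(1 − u_{R+1,1})` of the far region, integrating `∑ᵢ ∂ᵢ(ζ² ψ̃ J^{i+1}[ψ̃])` (and the
same for `χ̃`) by parts over the slice `{t* = 0}` and inserting `∑_μ ∂_μ J^μ = □_g ψ = 0`,
`∂₀ J⁰[ψ̃] = ν J⁰[ψ̃] − ω J⁰[χ̃]` (`kerr_sum_fderiv_current_succ`) and the pointwise Lagrangian
inequality (`kerr_lagrangian_pointwise`) bounds the cut-off gradient energy
`∫ ζ² (|∇ψ̃|² + |∇χ̃|²) dy`, hence the cut-off coordinate energy `∫ ζ² (e_ψ + e_χ) dy`, by an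
explicit constant times the volume of the ball of radius `R + 2`
(`kerrModePair_cutoff_energy_le`). This is the only place where the boundedness of the pair
enters the energy argument of the item. No new definitions.
-/

noncomputable section
namespace Summit.FinalStateConjecture.FinalStateConjecture.Theorems
open Literature.Geometry.Lorentzian Set Filter MeasureTheory
open scoped Manifold ContDiff Topology

-- every `Summit.FinalStateConjecture.FinalStateConjecture.…` name repeats the summit = sub-problem segment (D-0017 layout)
set_option linter.dupNamespace false

-- one long bookkeeping proof (cut-offs, two integrations by parts, pointwise algebra, three
-- integral estimates); the default budget is exceeded by the accumulated elaboration, not by search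
set_option maxHeartbeats 800000 in
/-- **The cut-off energy bound (Lagrangian identity).** Let `(M, a)` be subextremal,
`r₀ < r₊`, `(ψ, χ)` a smooth Killing-mode pair on `Kerr.region a r₀` (`□ψ = □χ = 0`,
`∂₀ψ = νψ − ωχ`, `∂₀χ = ωψ + νχ` on `{r > r₊}`) with `|ψ|, |χ| ≤ C_b` on `{r > r₊, t* ≤ 0}`, `K` a
bound for `|smoothTransition'|`, `R ≥ 0`, and `ζ` the annular cut-off of the far region
(`= 1` on `{R_far + 2 ≤ ‖y‖ ≤ R + 1}`, supported in `{R_far + 1 ≤ ‖y‖ ≤ R + 2}`). Then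
`y ↦ ζ(y)² (e_ψ + e_χ)(0, y)` is integrable and
`∫ ζ² (e_ψ + e_χ) ≤ (2α² + (9/4) C₂) · vol{‖y‖ ≤ R + 2}`, `α = (|ν| + |ω|) C_b`,
`C₂ = 132 α² + 2304 (2 K C_b)²`. -/
theorem kerrModePair_cutoff_energy_le [Kerr.Facts] [Kerr.SliceFacts] {M a r₀ : ℝ}
    (hMa : Kerr.IsSubextremal M a) (hr : r₀ < Kerr.rPlus M a)
    {ν w : ℝ} {ψ χ : Kerr.region a r₀ → ℝ}
    (hψ : ContMDiff 𝓘(ℝ, E4) 𝓘(ℝ, ℝ) ∞ ψ) (hχ : ContMDiff 𝓘(ℝ, E4) 𝓘(ℝ, ℝ) ∞ χ)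
    (H : ∀ x : Kerr.region a r₀, Kerr.rPlus M a < Kerr.radius a x.1 →
      (Kerr.smoothMetric M a r₀).toPseudoRiemannianMetric.dalembertian ψ x = 0 ∧
      (Kerr.smoothMetric M a r₀).toPseudoRiemannianMetric.dalembertian χ x = 0 ∧
      mfderiv 𝓘(ℝ, E4) 𝓘(ℝ, ℝ) ψ x (Kerr.stationaryField a r₀ x) = ν * ψ x - w * χ x ∧
      mfderiv 𝓘(ℝ, E4) 𝓘(ℝ, ℝ) χ x (Kerr.stationaryField a r₀ x) = w * ψ x + ν * χ x)
    {Cb : ℝ} (hbdd : ∀ x : Kerr.region a r₀, Kerr.rPlus M a < Kerr.radius a x.1 → (x : E4) 0 ≤ 0 →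
      |ψ x| ≤ Cb ∧ |χ x| ≤ Cb)
    {K : ℝ} (hK : ∀ t, |deriv Real.smoothTransition t| ≤ K) {R : ℝ} (hR : 0 ≤ R)
    (ζ : E3 → ℝ) (hζ_def : ζ = fun y : E3 ↦
      radialTransition (Kerr.farRadius M a + 1) 1 y * (1 - radialTransition (R + 1) 1 y)) :
    Integrable (fun y : E3 ↦ ζ y ^ 2 *
        (coordEnergyDensity (Kerr.region a r₀) ψ (E4.ofTimeSpace 0 y) +
          coordEnergyDensity (Kerr.region a r₀) χ (E4.ofTimeSpace 0 y))) ∧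
      ∫ y : E3, ζ y ^ 2 *
          (coordEnergyDensity (Kerr.region a r₀) ψ (E4.ofTimeSpace 0 y) +
            coordEnergyDensity (Kerr.region a r₀) χ (E4.ofTimeSpace 0 y)) ≤
        (2 * ((|ν| + |w|) * Cb) ^ 2 +
            9 / 4 * (132 * ((|ν| + |w|) * Cb) ^ 2 + 2304 * (Cb * (2 * K)) ^ 2)) *
          volume.real (Metric.closedBall (0 : E3) (R + 2)) := by
  classical
  have hM : 0 < M := hMa.pos
  have hK0 : 0 ≤ K := (abs_nonneg _).trans (hK 0)
  set rp := Kerr.rPlus M a with hrp_def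
  set fR := Kerr.farRadius M a with hfR_def
  have hfR : 0 < fR := Kerr.farRadius_pos M a
  set Φ : E4 → ℝ := Function.extend Subtype.val ψ 0 with hΦ_def
  set X : E4 → ℝ := Function.extend Subtype.val χ 0 with hX_def
  have heigψ := fun x hx ↦ (H x hx).2.2.1
  have heigχ : ∀ x : Kerr.region a r₀, rp < Kerr.radius a x.1 →
      mfderiv 𝓘(ℝ, E4) 𝓘(ℝ, ℝ) χ x (Kerr.stationaryField a r₀ x) = ν * χ x - (-w) * ψ x :=
    fun x hx ↦ by rw [(H x hx).2.2.2]; ring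
  -- ### the far region of the slice
  set Ω : Set E3 := {y : E3 | fR < ‖y‖} with hΩ_def
  have hΩopen : IsOpen Ω := isOpen_lt continuous_const continuous_norm
  have hΩext : ∀ y ∈ Ω, E4.ofTimeSpace 0 y ∈ Kerr.exterior M a := fun y hy ↦
    Kerr.ofTimeSpace_mem_exterior_iff.mpr
      (Kerr.mem_slice_of_lt_norm ((Kerr.afRadius_lt_farRadius M a).trans hy))
  have hΩr : ∀ y ∈ Ω, rp < Kerr.radius a (E4.ofTimeSpace 0 y) := fun y hy ↦
    kerr_rPlus_lt_of_mem_exterior hMa (hΩext y hy)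
  have hΩreg : ∀ y ∈ Ω, E4.ofTimeSpace 0 y ∈ Kerr.region a r₀ := fun y hy ↦
    Kerr.region_mono a hr.le (hΩext y hy)
  -- ### the cut-off
  have hζs : ContDiff ℝ ∞ ζ := hζ_def ▸ kerr_contDiff_annularCutoff (by linarith) (by linarith)
  have hζ1 : ContDiff ℝ 1 ζ := hζs.of_le (by norm_cast)
  have hζd : ∀ y, DifferentiableAt ℝ ζ y := fun y ↦ (hζ1.differentiable (by simp)) y
  have hζabs : ∀ y, |ζ y| ≤ 1 := fun y ↦ hζ_def ▸ kerr_abs_annularCutoff_le _ _ y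
  have hζslope : ∀ y, ‖fderiv ℝ ζ y‖ ≤ 2 * K := fun y ↦ by
    rw [hζ_def]; exact kerr_norm_fderiv_annularCutoff_le (by linarith) (by linarith) hK y
  have hζts : tsupport ζ ⊆ Ω := by
    rw [hζ_def]
    exact (kerr_tsupport_annularCutoff_subset _ _).trans fun y hy ↦ by
      have hy' : fR + 1 ≤ ‖y‖ := hy
      show fR < ‖y‖
      linarith
  have hζtc : tsupport ζ ⊆ Metric.closedBall (0 : E3) (R + 2) :=
    hζ_def ▸ kerr_tsupport_annularCutoff_subset_closedBall _ _
  have hζc : HasCompactSupport ζ := hζ_def ▸ kerr_hasCompactSupport_annularCutoff _ _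
  have hζ2s : ContDiff ℝ ∞ fun y ↦ ζ y ^ 2 := hζs.pow 2
  have hζ2supp : Function.support (fun y ↦ ζ y ^ 2) ⊆ Function.support ζ := fun y hy ↦ by
    simp only [Function.mem_support, ne_eq] at hy ⊢
    exact fun h ↦ hy (by rw [h, zero_pow two_ne_zero])
  have hζ2ts : tsupport (fun y ↦ ζ y ^ 2) ⊆ Ω := (closure_mono hζ2supp).trans hζts
  have hΦs : ∀ z : Kerr.region a r₀, ContDiffAt ℝ ∞ Φ z := fun z ↦ contDiffAt_extend hψ z
  have hXs : ∀ z : Kerr.region a r₀, ContDiffAt ℝ ∞ X z := fun z ↦ contDiffAt_extend hχ z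
  set JΦ : Fin 4 → E4 → ℝ := fun μ z ↦ ∑ ν', Kerr.inverseMetric M a z μ ν' *
    fderiv ℝ Φ z (E4.basisVector ν') with hJΦ
  set JX : Fin 4 → E4 → ℝ := fun μ z ↦ ∑ ν', Kerr.inverseMetric M a z μ ν' *
    fderiv ℝ X z (E4.basisVector ν') with hJX
  have hJΦs : ∀ z : Kerr.region a r₀, ∀ μ, ContDiffAt ℝ ∞ (JΦ μ) z := fun z μ ↦
    kerr_contDiffAt_current hψ z μ
  have hJXs : ∀ z : Kerr.region a r₀, ∀ μ, ContDiffAt ℝ ∞ (JX μ) z := fun z μ ↦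
    kerr_contDiffAt_current hχ z μ
  -- integration by parts, for each `i` and each of `Φ`, `X`
  have hIBP : ∀ (J : Fin 4 → E4 → ℝ) (F : E4 → ℝ), (∀ z : Kerr.region a r₀, ∀ μ, ContDiffAt ℝ ∞ (J μ) z) →
      (∀ z : Kerr.region a r₀, ContDiffAt ℝ ∞ F z) → ∀ i : Fin 3,
      Integrable (fun y ↦ fderiv ℝ (fun y ↦ J i.succ (E4.ofTimeSpace 0 y)) y (EuclideanSpace.single i 1) *
          (ζ y ^ 2 * F (E4.ofTimeSpace 0 y)) +
        J i.succ (E4.ofTimeSpace 0 y) *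
          fderiv ℝ (fun y ↦ ζ y ^ 2 * F (E4.ofTimeSpace 0 y)) y (EuclideanSpace.single i 1)) ∧
      ∫ y, (fderiv ℝ (fun y ↦ J i.succ (E4.ofTimeSpace 0 y)) y (EuclideanSpace.single i 1) *
          (ζ y ^ 2 * F (E4.ofTimeSpace 0 y)) +
        J i.succ (E4.ofTimeSpace 0 y) *
          fderiv ℝ (fun y ↦ ζ y ^ 2 * F (E4.ofTimeSpace 0 y)) y (EuclideanSpace.single i 1)) = 0 :=
    fun J F hJ hF i ↦ kerr_slice_ibp hΩopen hΩreg hζ2s hζ2ts hζtc (fun z ↦ hJ z i.succ) hF i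
  -- ### densities
  set aΦ : E3 → Fin 4 → ℝ := fun y μ ↦ fderiv ℝ Φ (E4.ofTimeSpace 0 y) (E4.basisVector μ) with haΦ
  set aX : E3 → Fin 4 → ℝ := fun y μ ↦ fderiv ℝ X (E4.ofTimeSpace 0 y) (E4.basisVector μ) with haX
  set G : E3 → ℝ := fun y ↦ (∑ i : Fin 3, (aΦ y i.succ) ^ 2) + ∑ i : Fin 3, (aX y i.succ) ^ 2
    with hG
  have hG0 : ∀ y, 0 ≤ G y := fun y ↦
    add_nonneg (Finset.sum_nonneg fun _ _ ↦ sq_nonneg _) (Finset.sum_nonneg fun _ _ ↦ sq_nonneg _)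
  have he_eq : ∀ y, coordEnergyDensity (Kerr.region a r₀) ψ (E4.ofTimeSpace 0 y) +
      coordEnergyDensity (Kerr.region a r₀) χ (E4.ofTimeSpace 0 y) =
      ((aΦ y 0) ^ 2 + (aX y 0) ^ 2) + G y := by
    intro y
    simp only [coordEnergyDensity, hG, haΦ, haX, Fin.sum_univ_succ (n := 3)]
    ring
  set α : ℝ := (|ν| + |w|) * Cb with hα
  set C₂ : ℝ := 132 * ((|ν| + |w|) * Cb) ^ 2 + 2304 * (Cb * (2 * K)) ^ 2 with hC₂
  have hC₂0 : 0 ≤ C₂ := by positivity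
  -- ### the integrands `I J F i` and their sums
  set IΦ : Fin 3 → E3 → ℝ := fun i y ↦
    fderiv ℝ (fun y ↦ JΦ i.succ (E4.ofTimeSpace 0 y)) y (EuclideanSpace.single i 1) *
        (ζ y ^ 2 * Φ (E4.ofTimeSpace 0 y)) +
      JΦ i.succ (E4.ofTimeSpace 0 y) *
        fderiv ℝ (fun y ↦ ζ y ^ 2 * Φ (E4.ofTimeSpace 0 y)) y (EuclideanSpace.single i 1) with hIΦ
  set IX : Fin 3 → E3 → ℝ := fun i y ↦
    fderiv ℝ (fun y ↦ JX i.succ (E4.ofTimeSpace 0 y)) y (EuclideanSpace.single i 1) *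
        (ζ y ^ 2 * X (E4.ofTimeSpace 0 y)) +
      JX i.succ (E4.ofTimeSpace 0 y) *
        fderiv ℝ (fun y ↦ ζ y ^ 2 * X (E4.ofTimeSpace 0 y)) y (EuclideanSpace.single i 1) with hIX
  have hIΦi : ∀ i, Integrable (IΦ i) ∧ ∫ y, IΦ i y = 0 := fun i ↦ hIBP JΦ Φ hJΦs hΦs i
  have hIXi : ∀ i, Integrable (IX i) ∧ ∫ y, IX i y = 0 := fun i ↦ hIBP JX X hJXs hXs i
  set FΦ : E3 → ℝ := fun y ↦ IΦ 0 y + IΦ 1 y + IΦ 2 y with hFΦ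
  set FX : E3 → ℝ := fun y ↦ IX 0 y + IX 1 y + IX 2 y with hFX
  have hFΦint : Integrable FΦ := ((hIΦi 0).1.add (hIΦi 1).1).add (hIΦi 2).1
  have hFXint : Integrable FX := ((hIXi 0).1.add (hIXi 1).1).add (hIXi 2).1
  have hFΦ0 : ∫ y, FΦ y = 0 := by
    have h1 := integral_add (μ := (volume : Measure E3)) (hIΦi 0).1 (hIΦi 1).1
    have h2 := integral_add (μ := (volume : Measure E3)) ((hIΦi 0).1.add (hIΦi 1).1) (hIΦi 2).1
    simp only [Pi.add_apply] at h1 h2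
    have h3 : ∫ y, FΦ y = ∫ y, (IΦ 0 y + IΦ 1 y) + IΦ 2 y := rfl
    rw [h3, h2, h1, (hIΦi 0).2, (hIΦi 1).2, (hIΦi 2).2]
    norm_num
  have hFX0 : ∫ y, FX y = 0 := by
    have h1 := integral_add (μ := (volume : Measure E3)) (hIXi 0).1 (hIXi 1).1
    have h2 := integral_add (μ := (volume : Measure E3)) ((hIXi 0).1.add (hIXi 1).1) (hIXi 2).1
    simp only [Pi.add_apply] at h1 h2
    have h3 : ∫ y, FX y = ∫ y, (IX 0 y + IX 1 y) + IX 2 y := rfl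
    rw [h3, h2, h1, (hIXi 0).2, (hIXi 1).2, (hIXi 2).2]
    norm_num
  -- ### the pointwise inequality
  set ind : E3 → ℝ := (Metric.closedBall (0 : E3) (R + 2)).indicator (fun _ ↦ (1 : ℝ)) with hind
  have hPWb : ∀ y : E3, (4 / 9 * (ζ y ^ 2 * G y) ≤ FΦ y + FX y + C₂ * ind y) ∧
      ζ y ^ 2 * ((aΦ y 0) ^ 2 + (aX y 0) ^ 2) ≤ 2 * α ^ 2 * ind y := by
    intro y
    by_cases hy : y ∈ tsupport ζ
    · -- on the support: the far-region computation
      have hyΩ : y ∈ Ω := hζts hy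
      have hyr : rp < Kerr.radius a (E4.ofTimeSpace 0 y) := hΩr y hyΩ
      have hyreg : E4.ofTimeSpace 0 y ∈ Kerr.region a r₀ := hΩreg y hyΩ
      set x : Kerr.region a r₀ := ⟨E4.ofTimeSpace 0 y, hyreg⟩ with hx
      have hx0 : (x : E4) 0 = 0 := by simp [hx]
      have hr0 : 0 < Kerr.radius a (x : E4) := Kerr.radius_pos_of_mem_region x.2
      have hfar : Kerr.farRadius M a ≤ E4.spatialNorm (x : E4) := by
        simp only [hx, E4.spatialNorm_ofTimeSpace]; exact le_of_lt hyΩ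
      -- differentiability at `x`
      have hΦd : DifferentiableAt ℝ Φ (E4.ofTimeSpace 0 y) := (hΦs x).differentiableAt (by simp)
      have hXd : DifferentiableAt ℝ X (E4.ofTimeSpace 0 y) := (hXs x).differentiableAt (by simp)
      have hJΦd : ∀ μ, DifferentiableAt ℝ (JΦ μ) (E4.ofTimeSpace 0 y) := fun μ ↦
        (hJΦs x μ).differentiableAt (by simp)
      have hJXd : ∀ μ, DifferentiableAt ℝ (JX μ) (E4.ofTimeSpace 0 y) := fun μ ↦
        (hJXs x μ).differentiableAt (by simp)
      -- the pieces of the integrands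
      have hV : ∀ (J : Fin 4 → E4 → ℝ), (∀ μ, DifferentiableAt ℝ (J μ) (E4.ofTimeSpace 0 y)) →
          ∀ i : Fin 3, fderiv ℝ (fun y ↦ J i.succ (E4.ofTimeSpace 0 y)) y (EuclideanSpace.single i 1) =
            fderiv ℝ (J i.succ) (E4.ofTimeSpace 0 y) (E4.basisVector i.succ) :=
        fun J hJ i ↦ kerr_fderiv_comp_ofTimeSpace_single (hJ i.succ) i
      have hgd : ∀ (F : E4 → ℝ), DifferentiableAt ℝ F (E4.ofTimeSpace 0 y) → ∀ i : Fin 3,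
          fderiv ℝ (fun y ↦ ζ y ^ 2 * F (E4.ofTimeSpace 0 y)) y (EuclideanSpace.single i 1) =
            2 * ζ y * fderiv ℝ ζ y (EuclideanSpace.single i 1) * F (E4.ofTimeSpace 0 y) +
              ζ y ^ 2 * fderiv ℝ F (E4.ofTimeSpace 0 y) (E4.basisVector i.succ) :=
        fun F hF i ↦ kerr_fderiv_cutoff_sq_mul (hζd y) hF i
      -- the spatial divergences of the currents
      have hsumΦ : ∑ i : Fin 3, fderiv ℝ (JΦ i.succ) (E4.ofTimeSpace 0 y) (E4.basisVector i.succ) =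
          -(ν * JΦ 0 (E4.ofTimeSpace 0 y) - w * JX 0 (E4.ofTimeSpace 0 y)) :=
        kerr_sum_fderiv_current_succ hψ hχ heigψ x hyr (H x hyr).1
      have hsumX : ∑ i : Fin 3, fderiv ℝ (JX i.succ) (E4.ofTimeSpace 0 y) (E4.basisVector i.succ) =
          -(ν * JX 0 (E4.ofTimeSpace 0 y) - (-w) * JΦ 0 (E4.ofTimeSpace 0 y)) :=
        kerr_sum_fderiv_current_succ hχ hψ heigχ x hyr (H x hyr).2.1
      -- abbreviations
      set z : ℝ := ζ y with hz_def
      set d : Fin 3 → ℝ := fun i ↦ fderiv ℝ ζ y (EuclideanSpace.single i 1) with hd_def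
      set Φ₀ : ℝ := Φ (E4.ofTimeSpace 0 y) with hΦ₀
      set X₀ : ℝ := X (E4.ofTimeSpace 0 y) with hX₀
      set Ja : Fin 4 → ℝ := fun μ ↦ JΦ μ (E4.ofTimeSpace 0 y) with hJa
      set Jb : Fin 4 → ℝ := fun μ ↦ JX μ (E4.ofTimeSpace 0 y) with hJb
      -- the integrands in closed form
      have hFΦy : FΦ y = -(ν * Ja 0 - w * Jb 0) * (z ^ 2 * Φ₀) +
          ∑ i : Fin 3, Ja i.succ * (2 * z * d i * Φ₀ + z ^ 2 * aΦ y i.succ) := by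
        have h3 := hsumΦ
        rw [Fin.sum_univ_three] at h3
        rw [Fin.sum_univ_three]
        simp only [hFΦ, hIΦ, hV JΦ hJΦd, hgd Φ hΦd, haΦ, hJa, hz_def, hd_def, hΦ₀]
        linear_combination (ζ y ^ 2 * Φ (E4.ofTimeSpace 0 y)) * h3
      have hFXy : FX y = -(ν * Jb 0 - (-w) * Ja 0) * (z ^ 2 * X₀) +
          ∑ i : Fin 3, Jb i.succ * (2 * z * d i * X₀ + z ^ 2 * aX y i.succ) := by
        have h3 := hsumX
        rw [Fin.sum_univ_three] at h3
        rw [Fin.sum_univ_three]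
        simp only [hFX, hIX, hV JX hJXd, hgd X hXd, haX, hJb, hz_def, hd_def, hX₀]
        linear_combination (ζ y ^ 2 * X (E4.ofTimeSpace 0 y)) * h3
      -- hypotheses of the algebraic lemma
      have hh : 2 * Kerr.scalarH M a (x : E4) ≤ 1 / 72 :=
        Kerr.two_mul_scalarH_le_of_farRadius_le hMa (hΩext y hyΩ) hfar
      have hg : ∀ μ ν', |Kerr.inverseMetric M a (E4.ofTimeSpace 0 y) μ ν' - Kerr.etaComp μ ν'| ≤
          2 * Kerr.scalarH M a (x : E4) := fun μ ν' ↦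
        Kerr.abs_inverseMetric_sub_etaComp_le hM.le a hr0 μ ν'
      have hbd := hbdd x hyr (le_of_eq hx0)
      rw [extend_rep ψ, extend_rep χ] at hbd
      have hΦ₀b : |Φ₀| ≤ Cb := hbd.1
      have hX₀b : |X₀| ≤ Cb := hbd.2
      have ha0 : aΦ y 0 = ν * Φ₀ - w * X₀ := by
        have h := heigψ x hyr
        rw [OpensChart.mfderiv_eq x ψ Φ (extend_rep ψ) hΦd, extend_rep ψ, extend_rep χ] at h
        exact h
      have hb0 : aX y 0 = w * Φ₀ + ν * X₀ := by
        have h := (H x hyr).2.2.2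
        rw [OpensChart.mfderiv_eq x χ X (extend_rep χ) hXd, extend_rep ψ, extend_rep χ] at h
        exact h
      have hzb : |z| ≤ 1 := hζabs y
      have hdb : ∀ i, |d i| ≤ 2 * K := by
        intro i
        calc |d i| = ‖fderiv ℝ ζ y (EuclideanSpace.single i 1)‖ := (Real.norm_eq_abs _).symm
          _ ≤ ‖fderiv ℝ ζ y‖ * ‖(EuclideanSpace.single i (1 : ℝ) : E3)‖ :=
              ContinuousLinearMap.le_opNorm _ _
          _ ≤ 2 * K * 1 := by
              gcongr
              · exact hζslope y
              · simp
          _ = 2 * K := mul_one _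
      have halg := kerr_lagrangian_pointwise (g := fun μ ν' ↦ Kerr.inverseMetric M a
        (E4.ofTimeSpace 0 y) μ ν') hh hg (aΦ y) (aX y) Ja Jb (fun μ ↦ rfl) (fun μ ↦ rfl) d
        hΦ₀b hX₀b ha0 hb0 hzb hdb
      have hind1 : ind y = 1 := by
        simp only [hind]
        rw [Set.indicator_of_mem (hζtc hy)]
      rw [hFΦy, hFXy, hind1, mul_one, mul_one]
      have : -(ν * Jb 0 - -w * Ja 0) = -(ν * Jb 0 + w * Ja 0) := by ring
      rw [this]
      refine ⟨by linarith [halg], ?_⟩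
      -- the time components
      obtain ⟨h1, h2⟩ := kerr_abs_timeComponents_le (ν := ν) (w := w) hΦ₀b hX₀b
      rw [← ha0] at h1
      rw [← hb0] at h2
      have h1' : (aΦ y 0) ^ 2 ≤ α ^ 2 := by
        rw [← sq_abs]; exact pow_le_pow_left₀ (abs_nonneg _) h1 2
      have h2' : (aX y 0) ^ 2 ≤ α ^ 2 := by
        rw [← sq_abs]; exact pow_le_pow_left₀ (abs_nonneg _) h2 2
      have hz2 : ζ y ^ 2 ≤ 1 := by
        have := pow_le_pow_left₀ (abs_nonneg _) (hζabs y) 2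
        rwa [sq_abs, one_pow] at this
      calc ζ y ^ 2 * ((aΦ y 0) ^ 2 + (aX y 0) ^ 2) ≤ 1 * (2 * α ^ 2) :=
            mul_le_mul hz2 (by linarith) (by positivity) zero_le_one
        _ = 2 * α ^ 2 := one_mul _
    · -- off the support: everything vanishes
      have hev : ζ =ᶠ[𝓝 y] fun _ ↦ 0 := notMem_tsupport_iff_eventuallyEq.mp hy
      have hz0 : ζ y = 0 := hev.eq_of_nhds
      have hg0 : ∀ (F : E4 → ℝ), (fun y ↦ ζ y ^ 2 * F (E4.ofTimeSpace 0 y)) y = 0 ∧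
          fderiv ℝ (fun y ↦ ζ y ^ 2 * F (E4.ofTimeSpace 0 y)) y = 0 := by
        intro F
        have hev2 : (fun y ↦ ζ y ^ 2 * F (E4.ofTimeSpace 0 y)) =ᶠ[𝓝 y] fun _ ↦ 0 := by
          filter_upwards [hev] with y' hy'
          rw [hy', zero_pow two_ne_zero, zero_mul]
        refine ⟨by simp only [hz0, zero_pow two_ne_zero, zero_mul], ?_⟩
        rw [hev2.fderiv_eq]; simp
      have hIΦ0 : ∀ i, IΦ i y = 0 := by
        intro i
        simp only [hIΦ]
        rw [(hg0 Φ).2]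
        simp [hz0]
      have hIX0 : ∀ i, IX i y = 0 := by
        intro i
        simp only [hIX]
        rw [(hg0 X).2]
        simp [hz0]
      have hF0 : FΦ y = 0 ∧ FX y = 0 := by
        constructor
        · simp only [hFΦ, hIΦ0, add_zero]
        · simp only [hFX, hIX0, add_zero]
      have hind0 : 0 ≤ ind y := by
        simp only [hind]; exact Set.indicator_nonneg (fun _ _ ↦ zero_le_one) y
      rw [hF0.1, hF0.2, hz0, zero_pow two_ne_zero, zero_mul, zero_mul, mul_zero]
      exact ⟨by positivity, mul_nonneg (by positivity) hind0⟩
  have hPW : ∀ y : E3, 4 / 9 * (ζ y ^ 2 * G y) ≤ FΦ y + FX y + C₂ * ind y := fun y ↦ (hPWb y).1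
  -- ### integrability of the cut-off densities
  have hcontG : ContinuousOn G Ω := by
    intro y hy
    have hc : ∀ (F : E4 → ℝ), (∀ z : Kerr.region a r₀, ContDiffAt ℝ ∞ F z) → ∀ μ,
        ContinuousAt (fun y ↦ fderiv ℝ F (E4.ofTimeSpace 0 y) (E4.basisVector μ)) y :=
      fun F hF μ ↦ kerr_continuousAt_fderiv_slice (hF ⟨_, hΩreg y hy⟩) (by simp) _
    refine ContinuousAt.continuousWithinAt ?_
    simp only [hG, haΦ, haX, Fin.sum_univ_three]
    exact ((((hc Φ hΦs (Fin.succ 0)).pow 2).add ((hc Φ hΦs (Fin.succ 1)).pow 2)).add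
      ((hc Φ hΦs (Fin.succ 2)).pow 2)).add
      ((((hc X hXs (Fin.succ 0)).pow 2).add ((hc X hXs (Fin.succ 1)).pow 2)).add
        ((hc X hXs (Fin.succ 2)).pow 2))
  have hcont0 : ContinuousOn (fun y ↦ (aΦ y 0) ^ 2 + (aX y 0) ^ 2) Ω := by
    intro y hy
    have hc : ∀ (F : E4 → ℝ), (∀ z : Kerr.region a r₀, ContDiffAt ℝ ∞ F z) → ∀ μ,
        ContinuousAt (fun y ↦ fderiv ℝ F (E4.ofTimeSpace 0 y) (E4.basisVector μ)) y :=
      fun F hF μ ↦ kerr_continuousAt_fderiv_slice (hF ⟨_, hΩreg y hy⟩) (by simp) _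
    exact (((hc Φ hΦs 0).pow 2).add ((hc X hXs 0).pow 2)).continuousWithinAt
  have hζ2c : Continuous fun y ↦ ζ y ^ 2 := hζ2s.continuous
  have hζ2cs : HasCompactSupport fun y ↦ ζ y ^ 2 :=
    hζc.mono (hζ2supp)
  have hGint : Integrable fun y ↦ G y * ζ y ^ 2 :=
    (continuous_mul_of_continuousOn hΩopen hcontG hζ2c hζ2ts).integrable_of_hasCompactSupport
      (hζ2cs.mul_left)
  have h0int : Integrable fun y ↦ ((aΦ y 0) ^ 2 + (aX y 0) ^ 2) * ζ y ^ 2 :=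
    (continuous_mul_of_continuousOn hΩopen hcont0 hζ2c hζ2ts).integrable_of_hasCompactSupport
      (hζ2cs.mul_left)
  have hvol : volume (Metric.closedBall (0 : E3) (R + 2)) ≠ ⊤ := measure_closedBall_lt_top.ne
  have hindint : Integrable ind :=
    (integrableOn_const hvol).integrable_indicator measurableSet_closedBall
  have hind_int : ∫ y, ind y = volume.real (Metric.closedBall (0 : E3) (R + 2)) := by
    simp only [hind]
    rw [integral_indicator_const _ measurableSet_closedBall, smul_eq_mul, mul_one]
  -- ### the gradient energy
  have hGint' : Integrable fun y ↦ ζ y ^ 2 * G y := hGint.congr (ae_of_all _ fun y ↦ by ring)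
  have hgrad : ∫ y, ζ y ^ 2 * G y ≤ 9 / 4 * C₂ * volume.real (Metric.closedBall (0 : E3) (R + 2)) := by
    have h1 : ∫ y, 4 / 9 * (ζ y ^ 2 * G y) ≤ ∫ y, (FΦ y + FX y + C₂ * ind y) :=
      integral_mono (hGint'.const_mul _) ((hFΦint.add hFXint).add (hindint.const_mul _)) hPW
    have hL : ∫ y, 4 / 9 * (ζ y ^ 2 * G y) = 4 / 9 * ∫ y, ζ y ^ 2 * G y := integral_const_mul _ _
    have hR1 := integral_add (μ := (volume : Measure E3)) (hFΦint.add hFXint) (hindint.const_mul C₂)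
    have hR2 := integral_add (μ := (volume : Measure E3)) hFΦint hFXint
    have hR3 : ∫ y, C₂ * ind y = C₂ * ∫ y, ind y := integral_const_mul _ _
    simp only [Pi.add_apply] at hR1 hR2
    rw [hR2, hFΦ0, hFX0, hR3, hind_int] at hR1
    rw [hL, hR1] at h1
    linarith
  -- ### the cut-off energy
  have hint : Integrable (fun y : E3 ↦ ζ y ^ 2 *
      (coordEnergyDensity (Kerr.region a r₀) ψ (E4.ofTimeSpace 0 y) +
        coordEnergyDensity (Kerr.region a r₀) χ (E4.ofTimeSpace 0 y))) := by
    refine (h0int.add hGint).congr (ae_of_all _ fun y ↦ ?_)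
    simp only [Pi.add_apply]
    rw [he_eq y]; ring
  refine ⟨hint, ?_⟩
  have hPW2 : ∀ y, ζ y ^ 2 * (coordEnergyDensity (Kerr.region a r₀) ψ (E4.ofTimeSpace 0 y) +
      coordEnergyDensity (Kerr.region a r₀) χ (E4.ofTimeSpace 0 y)) ≤
      2 * α ^ 2 * ind y + ζ y ^ 2 * G y := fun y ↦ by
    rw [he_eq y, mul_add]
    exact add_le_add (hPWb y).2 le_rfl
  have hRint : Integrable (fun y ↦ 2 * α ^ 2 * ind y + ζ y ^ 2 * G y) :=
    (hindint.const_mul _).add hGint'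
  have hmono := integral_mono hint hRint hPW2
  calc ∫ y, ζ y ^ 2 * (coordEnergyDensity (Kerr.region a r₀) ψ (E4.ofTimeSpace 0 y) +
          coordEnergyDensity (Kerr.region a r₀) χ (E4.ofTimeSpace 0 y))
      ≤ ∫ y, (2 * α ^ 2 * ind y + ζ y ^ 2 * G y) := hmono
    _ = 2 * α ^ 2 * volume.real (Metric.closedBall (0 : E3) (R + 2)) + ∫ y, ζ y ^ 2 * G y := by
        have hA := integral_add (μ := (volume : Measure E3)) (hindint.const_mul (2 * α ^ 2)) hGint'
        have hB : ∫ y, 2 * α ^ 2 * ind y = 2 * α ^ 2 * ∫ y, ind y := integral_const_mul _ _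
        rw [hA, hB, hind_int]
    _ ≤ 2 * α ^ 2 * volume.real (Metric.closedBall (0 : E3) (R + 2)) +
          9 / 4 * C₂ * volume.real (Metric.closedBall (0 : E3) (R + 2)) := by linarith [hgrad]
    _ = (2 * ((|ν| + |w|) * Cb) ^ 2 +
            9 / 4 * (132 * ((|ν| + |w|) * Cb) ^ 2 + 2304 * (Cb * (2 * K)) ^ 2)) *
          volume.real (Metric.closedBall (0 : E3) (R + 2)) := by
        rw [hα, hC₂]; ring

end Summit.FinalStateConjecture.FinalStateConjecture.Theorems

end
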